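import Literature.Analysis.FunctionSpaces.LittlewoodPaleyKernel
import Mathlib.Analysis.Calculus.ContDiff.FTaylorSeries
import HarnessLib

/-!
# Littlewood–Paley blocks of smooth fields with bounded and square-integrable derivatives

Analysis/FunctionSpaces support file (serves the discharge of
`Literature.Analysis.FluidPDE.cheskidov_shvydkoy`, ns.S31). Cheskidov–Shvydkoy's a-priori estimate
(Lemma 3.2, arXiv:0708.3067 p. 5) is carried out on intervals of regularity, where every slice of
the solution is smooth with all derivatives bounded and square integrable (Ożański–Pooley 2018,
Cor. 6.16: `∇^m u ∈ C((0,T); L² ∩ L^∞)`). This file isolates the two function classes and shows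
that they are stable under the operations of the frequency-localised energy method, all **proved**:

* `HasBoundedDerivs v` (`C^∞` with `sup ‖Dⁿv‖ < ∞` for all `n`): closed under `D`, `∂_m`, constant
  linear maps, sums, scalar multiples and products (`smul`, Leibniz); **blocks of such fields are
  such fields** with `Dⁿ(Δ̇_j v) = Δ̇_j (Dⁿ v)` (`HasBoundedDerivs.iteratedFDeriv_blockFn`,
  `contDiff_blockFn`, `blockFn`), by induction on `n` from `D(Δ̇_j U) = Δ̇_j(DU)`
  (`LittlewoodPaleyKernel.lean`) and the commutation of `Δ̇_j` with constant linear maps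
  (bounded-field form `blockFn_comp_clm_of_bound`);
* `IsSmoothL2Field v` (in addition `∫⁻ ‖Dⁿv‖ₑ² < ∞` for all `n`): gives `v ∈ L²`, `∂_m v ∈ L²`, and is
  closed under `∂_m`, constant linear maps, sums, scalar multiples, products with `HasBoundedDerivs`
  scalars (`smul_left`) and **under the blocks** (`IsSmoothL2Field.blockFn`, Young's inequality).

## References

* W. S. Ożański, B. C. Pooley, in: PDE in Fluid Mechanics, LMS LN 452, CUP 2018, Cor. 6.16.
  [OzanskiPooley2018]
* H. Bahouri, J.-Y. Chemin, R. Danchin, *Fourier Analysis and Nonlinear PDE*, Springer 2011,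
  Lemma 2.1 (blocks and derivatives). [BCD]
-/

noncomputable section

open MeasureTheory Filter Topology Function
open scoped ENNReal NNReal

namespace Literature.Analysis.FunctionSpaces

/-! ## Smooth fields with bounded derivatives of all orders -/

section Bounded

variable {E : Type*} [NormedAddCommGroup E] [NormedSpace ℝ E]
variable {E' : Type*} [NormedAddCommGroup E'] [NormedSpace ℝ E']

/-- A field `v : E → E'` is **smooth with all derivatives bounded**: `v ∈ C^∞` and
`sup_x ‖Dⁿ v(x)‖ < ∞` for every `n` (the class `C_b^∞`; the slices of Leray's regular solutions,
Ożański–Pooley 2018, Cor. 6.16: `∇^m u ∈ C((0,T); L^∞)`). [folklore] -/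
structure HasBoundedDerivs (v : E → E') : Prop where
  /-- `v` is `C^∞`. -/
  contDiff : ContDiff ℝ (⊤ : ℕ∞) v
  /-- Every derivative is bounded. -/
  bounded : ∀ n : ℕ, ∃ M : ℝ, ∀ x, ‖iteratedFDeriv ℝ n v x‖ ≤ M

namespace HasBoundedDerivs

variable {v : E → E'}

/-- The field itself is bounded. [folklore] -/
theorem exists_norm_le (h : HasBoundedDerivs v) : ∃ M : ℝ, ∀ x, ‖v x‖ ≤ M := by
  obtain ⟨M, hM⟩ := h.bounded 0
  exact ⟨M, fun x => by simpa [norm_iteratedFDeriv_zero] using hM x⟩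

/-- The derivative is bounded. [folklore] -/
theorem exists_norm_fderiv_le (h : HasBoundedDerivs v) : ∃ M : ℝ, ∀ x, ‖fderiv ℝ v x‖ ≤ M := by
  obtain ⟨M, hM⟩ := h.bounded 1
  refine ⟨M, fun x => ?_⟩
  have := hM x
  rwa [← norm_iteratedFDeriv_fderiv, norm_iteratedFDeriv_zero] at this

/-- `v` is `Cⁿ` for every `n`. [folklore] -/
theorem contDiff_nat (h : HasBoundedDerivs v) (n : ℕ) : ContDiff ℝ n v :=
  h.contDiff.of_le (mod_cast le_top)

/-- `v` is continuous. [folklore] -/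
theorem continuous (h : HasBoundedDerivs v) : Continuous v := h.contDiff.continuous

/-- **Closure under differentiation**: `Dv` is smooth with all derivatives bounded. [folklore] -/
theorem fderiv (h : HasBoundedDerivs v) : HasBoundedDerivs (_root_.fderiv ℝ v) where
  contDiff := (contDiff_infty_iff_fderiv.1 h.contDiff).2
  bounded n := by
    obtain ⟨M, hM⟩ := h.bounded (n + 1)
    exact ⟨M, fun x => by rw [norm_iteratedFDeriv_fderiv]; exact hM x⟩

/-- **Closure under constant linear maps**: `L ∘ v` is smooth with all derivatives bounded. [folklore] -/
theorem clm_comp {E'' : Type*} [NormedAddCommGroup E''] [NormedSpace ℝ E''] (h : HasBoundedDerivs v)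
    (L : E' →L[ℝ] E'') : HasBoundedDerivs (fun x => L (v x)) where
  contDiff := L.contDiff.comp h.contDiff
  bounded n := by
    obtain ⟨M, hM⟩ := h.bounded n
    refine ⟨‖L‖ * M, fun x => ?_⟩
    have h1 : ‖iteratedFDeriv ℝ n (L ∘ v) x‖ ≤ ‖L‖ * ‖iteratedFDeriv ℝ n v x‖ :=
      L.norm_iteratedFDeriv_comp_left h.contDiff.contDiffAt (mod_cast le_top)
    exact h1.trans (mul_le_mul_of_nonneg_left (hM x) (norm_nonneg _))

/-- Directional derivatives are smooth with all derivatives bounded. [folklore] -/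
theorem fderiv_apply (h : HasBoundedDerivs v) (m : E) :
    HasBoundedDerivs (fun x => _root_.fderiv ℝ v x m) :=
  h.fderiv.clm_comp (ContinuousLinearMap.apply ℝ E' m)

/-- The zero field. [folklore] -/
theorem zero : HasBoundedDerivs (0 : E → E') where
  contDiff := contDiff_const
  bounded n := ⟨0, fun x => by simp [Pi.zero_def]⟩

/-- Sums. [folklore] -/
theorem add {w : E → E'} (hv : HasBoundedDerivs v) (hw : HasBoundedDerivs w) :
    HasBoundedDerivs (v + w) where
  contDiff := hv.contDiff.add hw.contDiff
  bounded n := by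
    obtain ⟨M, hM⟩ := hv.bounded n
    obtain ⟨M', hM'⟩ := hw.bounded n
    refine ⟨M + M', fun x => ?_⟩
    rw [iteratedFDeriv_add_apply (hv.contDiff_nat n).contDiffAt (hw.contDiff_nat n).contDiffAt]
    exact (norm_add_le _ _).trans (add_le_add (hM x) (hM' x))

/-- Scalar multiples. [folklore] -/
theorem const_smul (h : HasBoundedDerivs v) (c : ℝ) : HasBoundedDerivs (c • v) where
  contDiff := contDiff_const.smul h.contDiff
  bounded n := by
    obtain ⟨M, hM⟩ := h.bounded n
    refine ⟨‖c‖ * M, fun x => ?_⟩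
    rw [iteratedFDeriv_const_smul_apply (h.contDiff_nat n).contDiffAt, norm_smul]
    exact mul_le_mul_of_nonneg_left (hM x) (norm_nonneg _)

/-- **Products of a scalar and a vector field** (Leibniz, `norm_iteratedFDeriv_smul_le`). [folklore] -/
theorem smul {φ : E → ℝ} {w : E → E'} (hφ : HasBoundedDerivs φ) (hw : HasBoundedDerivs w) :
    HasBoundedDerivs (fun x => φ x • w x) where
  contDiff := hφ.contDiff.smul hw.contDiff
  bounded n := by
    choose M hM using hφ.bounded
    choose M' hM' using hw.bounded
    refine ⟨∑ i ∈ Finset.range (n + 1), (n.choose i : ℝ) * M i * M' (n - i), fun x => ?_⟩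
    refine (norm_iteratedFDeriv_smul_le hφ.contDiff hw.contDiff x (mod_cast le_top)).trans ?_
    refine Finset.sum_le_sum fun i _ => ?_
    have h0 : 0 ≤ M i := (norm_nonneg _).trans (hM i x)
    exact mul_le_mul (mul_le_mul_of_nonneg_left (hM i x) (Nat.cast_nonneg _)) (hM' _ x)
      (norm_nonneg _) (mul_nonneg (Nat.cast_nonneg _) h0)

end HasBoundedDerivs

end Bounded

/-! ## Blocks of smooth bounded fields -/

section Blocks

variable {E : Type*} [NormedAddCommGroup E] [InnerProductSpace ℝ E] [FiniteDimensional ℝ E]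
  [MeasurableSpace E] [BorelSpace E]
variable {E' : Type*} [NormedAddCommGroup E'] [NormedSpace ℝ E']

/-- A bounded continuous field is in `L^∞`. [folklore] -/
theorem memLp_top_of_hasBoundedDerivs {v : E → E'} (h : HasBoundedDerivs v) :
    MemLp v ∞ (volume : Measure E) := by
  obtain ⟨M, hM⟩ := h.exists_norm_le
  exact memLp_top_of_bound h.continuous.aestronglyMeasurable M (Eventually.of_forall hM)

/-- **Blocks of smooth bounded fields, first order**: `D(Δ̇_j v) = Δ̇_j (Dv)`. [folklore] -/
theorem HasBoundedDerivs.fderiv_blockFn {v : E → E'} (h : HasBoundedDerivs v) (j : ℤ) :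
    _root_.fderiv ℝ (blockFn j v) = blockFn j (_root_.fderiv ℝ v) := by
  obtain ⟨M₀, hM₀⟩ := h.exists_norm_le
  obtain ⟨M₁, hM₁⟩ := h.exists_norm_fderiv_le
  exact FunctionSpaces.fderiv_blockFn j (h.contDiff_nat 1) hM₀ hM₁

/-- **Blocks commute with constant linear maps**, bounded-field version of
`blockFn_comp_clm`: for a continuous linear `L` and a bounded measurable `v`,
`Δ̇_j (L ∘ v) = L ∘ Δ̇_j v`. [folklore] -/
theorem blockFn_comp_clm_of_bound {E'' : Type*} [NormedAddCommGroup E''] [NormedSpace ℝ E'']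
    [CompleteSpace E'] [CompleteSpace E''] (j : ℤ) (L : E' →L[ℝ] E'') {v : E → E'}
    (hv : AEStronglyMeasurable v volume) {M : ℝ} (hM : ∀ x, ‖v x‖ ≤ M) :
    blockFn j (fun x => L (v x)) = fun x => L (blockFn j v x) := by
  funext x
  simp only [blockFn_apply, ← L.map_smul]
  exact L.integral_comp_comm (integrable_blockKernel_smul_sub_of_bound j hv hM x)

/-- The iterated derivatives of a smooth bounded field are `C¹` with the field and its
derivative bounded (the hypotheses of `fderiv_blockFn`). [folklore] -/
theorem HasBoundedDerivs.fderiv_blockFn_iteratedFDeriv {v : E → E'} (h : HasBoundedDerivs v) (j : ℤ)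
    (n : ℕ) : _root_.fderiv ℝ (blockFn j (iteratedFDeriv ℝ n v)) =
      blockFn j (_root_.fderiv ℝ (iteratedFDeriv ℝ n v)) := by
  obtain ⟨M₀, hM₀⟩ := h.bounded n
  obtain ⟨M₁, hM₁⟩ := h.bounded (n + 1)
  refine FunctionSpaces.fderiv_blockFn j (h.contDiff.iteratedFDeriv_right (mod_cast le_top)) hM₀
    (M₁ := M₁) fun x => ?_
  rw [norm_fderiv_iteratedFDeriv]
  exact hM₁ x

/-- **`Dⁿ(Δ̇_j v) = Δ̇_j (Dⁿ v)` for smooth bounded fields** (induction on `n`: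
`Dⁿ⁺¹ f = curry⁻¹ ∘ D(Dⁿ f)`, `D(Δ̇_j U) = Δ̇_j (DU)` for `U = Dⁿ v`, and `Δ̇_j` commutes with constant
linear maps). [folklore] -/
theorem HasBoundedDerivs.iteratedFDeriv_blockFn [CompleteSpace E'] {v : E → E'} (h : HasBoundedDerivs v)
    (j : ℤ) (n : ℕ) : iteratedFDeriv ℝ n (blockFn j v) = blockFn j (iteratedFDeriv ℝ n v) := by
  haveI : Fact (1 ≤ (∞ : ℝ≥0∞)) := ⟨le_top⟩
  induction n with
  | zero =>
    rw [iteratedFDeriv_zero_eq_comp, iteratedFDeriv_zero_eq_comp]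
    exact (blockFn_comp_clm j
      ((continuousMultilinearCurryFin0 ℝ E E').symm : E' →L[ℝ] (E [×0]→L[ℝ] E'))
      (memLp_top_of_hasBoundedDerivs h)).symm
  | succ n ih =>
    rw [iteratedFDeriv_succ_eq_comp_left, iteratedFDeriv_succ_eq_comp_left, ih,
      h.fderiv_blockFn_iteratedFDeriv j n]
    obtain ⟨M, hM⟩ := h.bounded (n + 1)
    have hmeas : AEStronglyMeasurable (_root_.fderiv ℝ (iteratedFDeriv ℝ n v)) (volume : Measure E) :=
      ((h.contDiff.iteratedFDeriv_right (i := n) (m := 1) (mod_cast le_top)).continuous_fderiv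
        one_ne_zero).aestronglyMeasurable
    have hbound : ∀ x, ‖_root_.fderiv ℝ (iteratedFDeriv ℝ n v) x‖ ≤ M := fun x => by
      rw [norm_fderiv_iteratedFDeriv]; exact hM x
    set L : (E →L[ℝ] (E [×n]→L[ℝ] E')) →L[ℝ] (E [×(n + 1)]→L[ℝ] E') :=
      ((continuousMultilinearCurryLeftEquiv ℝ (fun _ : Fin (n + 1) => E) E').symm :
        (E →L[ℝ] (E [×n]→L[ℝ] E')) ≃ₗᵢ[ℝ] (E [×(n + 1)]→L[ℝ] E')).toContinuousLinearEquiv.toContinuousLinearMap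
      with hL
    have h2 := blockFn_comp_clm_of_bound (E' := E →L[ℝ] (E [×n]→L[ℝ] E')) j L hmeas (M := M)
      (fun x => hbound x)
    have hcoe : ∀ (g : E → (E →L[ℝ] (E [×n]→L[ℝ] E'))),
        (⇑(continuousMultilinearCurryLeftEquiv ℝ (fun _ : Fin (n + 1) => E) E').symm ∘ g) =
          fun x => L (g x) := fun g => rfl
    rw [hcoe, hcoe, h2]

/-- **Blocks of smooth bounded fields are smooth.** [folklore] -/
theorem HasBoundedDerivs.contDiff_blockFn [CompleteSpace E'] {v : E → E'} (h : HasBoundedDerivs v)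
    (j : ℤ) : ContDiff ℝ (⊤ : ℕ∞) (blockFn j v) := by
  refine contDiff_of_differentiable_iteratedFDeriv fun m _ => ?_
  rw [h.iteratedFDeriv_blockFn j m]
  obtain ⟨M₀, hM₀⟩ := h.bounded m
  obtain ⟨M₁, hM₁⟩ := h.bounded (m + 1)
  exact fun x => (hasFDerivAt_blockFn j (h.contDiff.iteratedFDeriv_right (mod_cast le_top)) hM₀
    (M₁ := M₁) (fun y => by rw [norm_fderiv_iteratedFDeriv]; exact hM₁ y) x).differentiableAt

/-- **Blocks of smooth bounded fields are smooth bounded fields**, with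
`‖Dⁿ(Δ̇_j v)‖_∞ ≤ ‖K_j‖_{L¹} ‖Dⁿ v‖_∞`. [folklore] -/
theorem HasBoundedDerivs.blockFn [CompleteSpace E'] {v : E → E'} (h : HasBoundedDerivs v) (j : ℤ) :
    HasBoundedDerivs (blockFn j v) where
  contDiff := h.contDiff_blockFn j
  bounded n := by
    obtain ⟨M, hM⟩ := h.bounded n
    refine ⟨(∫ t, ‖blockKernel E j t‖) * M, fun x => ?_⟩
    rw [h.iteratedFDeriv_blockFn j n]
    exact norm_blockFn_le_of_bound j hM x

/-! ## Smooth fields with square-integrable derivatives of all orders -/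

/-- `∫⁻ ‖f‖ₑ² < ∞ ↔ ‖f‖_{L²} < ∞`. [folklore] -/
theorem lintegral_enorm_sq_lt_top_iff {F : Type*} [NormedAddCommGroup F] {f : E → F} :
    ∫⁻ x, ‖f x‖ₑ ^ 2 < ∞ ↔ eLpNorm f 2 (volume : Measure E) < ∞ := by
  rw [eLpNorm_eq_lintegral_rpow_enorm_toReal two_ne_zero ENNReal.ofNat_ne_top, ENNReal.toReal_ofNat,
    ENNReal.rpow_lt_top_iff_of_pos (by norm_num : (0 : ℝ) < 1 / 2)]
  simp_rw [ENNReal.rpow_two]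

/-- `‖f‖²_{L²} = ∫⁻ ‖f‖ₑ²`. [folklore] -/
theorem eLpNorm_two_sq_eq_lintegral {F : Type*} [NormedAddCommGroup F] (f : E → F) :
    eLpNorm f 2 (volume : Measure E) ^ 2 = ∫⁻ x, ‖f x‖ₑ ^ 2 := by
  rw [eLpNorm_eq_lintegral_rpow_enorm_toReal two_ne_zero ENNReal.ofNat_ne_top, ENNReal.toReal_ofNat,
    ← ENNReal.rpow_natCast, ← ENNReal.rpow_mul]
  norm_num

/-- A field `v : E → E'` is a **smooth `L²` field**: smooth with all derivatives bounded and
square integrable, `Dⁿ v ∈ L² ∩ L^∞` for every `n` (the slices of Leray's regular solutions;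
Ożański–Pooley 2018, Cor. 6.16: `∇^m u ∈ C((0,T); L² ∩ L^∞)`). The square integrability is
recorded as `∫⁻ ‖Dⁿv‖ₑ² < ∞` (no measurability side condition). [folklore] -/
structure IsSmoothL2Field (v : E → E') : Prop extends HasBoundedDerivs v where
  /-- Every derivative is square integrable. -/
  sobolev : ∀ n : ℕ, ∫⁻ x, ‖iteratedFDeriv ℝ n v x‖ₑ ^ 2 < ∞

namespace IsSmoothL2Field

variable {v : E → E'}

/-- A smooth `L²` field is in `L²`. [folklore] -/
theorem memLp_two (h : IsSmoothL2Field v) : MemLp v 2 (volume : Measure E) := by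
  refine ⟨h.continuous.aestronglyMeasurable, ?_⟩
  rw [← lintegral_enorm_sq_lt_top_iff]
  have := h.sobolev 0
  simp_rw [← ofReal_norm, norm_iteratedFDeriv_zero] at this
  simpa [← ofReal_norm] using this

/-- The `L²` norm of the `n`-th derivative is finite. [folklore] -/
theorem eLpNorm_iteratedFDeriv_lt_top (h : IsSmoothL2Field v) (n : ℕ) :
    eLpNorm (iteratedFDeriv ℝ n v) 2 (volume : Measure E) < ∞ :=
  lintegral_enorm_sq_lt_top_iff.1 (h.sobolev n)

/-- **Closure under constant linear maps.** [folklore] -/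
theorem clm_comp {E'' : Type*} [NormedAddCommGroup E''] [NormedSpace ℝ E''] (h : IsSmoothL2Field v)
    (L : E' →L[ℝ] E'') : IsSmoothL2Field (fun x => L (v x)) where
  toHasBoundedDerivs := h.toHasBoundedDerivs.clm_comp L
  sobolev n := by
    have hle : ∀ x, ‖iteratedFDeriv ℝ n (fun x => L (v x)) x‖ₑ ^ 2 ≤
        ‖L‖ₑ ^ 2 * ‖iteratedFDeriv ℝ n v x‖ₑ ^ 2 := by
      intro x
      have h1 : ‖iteratedFDeriv ℝ n (L ∘ v) x‖ ≤ ‖L‖ * ‖iteratedFDeriv ℝ n v x‖ :=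
        L.norm_iteratedFDeriv_comp_left h.contDiff.contDiffAt (mod_cast le_top)
      rw [← mul_pow]
      gcongr
      rw [← ofReal_norm, ← ofReal_norm, ← ofReal_norm, ← ENNReal.ofReal_mul (norm_nonneg _)]
      exact ENNReal.ofReal_le_ofReal h1
    calc ∫⁻ x, ‖iteratedFDeriv ℝ n (fun x => L (v x)) x‖ₑ ^ 2
        ≤ ∫⁻ x, ‖L‖ₑ ^ 2 * ‖iteratedFDeriv ℝ n v x‖ₑ ^ 2 := lintegral_mono hle
      _ = ‖L‖ₑ ^ 2 * ∫⁻ x, ‖iteratedFDeriv ℝ n v x‖ₑ ^ 2 := lintegral_const_mul' _ _ (by simp)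
      _ < ∞ := ENNReal.mul_lt_top (by simp) (h.sobolev n)

/-- **Closure under differentiation in a direction.** [folklore] -/
theorem fderiv_apply (h : IsSmoothL2Field v) (m : E) :
    IsSmoothL2Field (fun x => _root_.fderiv ℝ v x m) where
  toHasBoundedDerivs := h.toHasBoundedDerivs.fderiv_apply m
  sobolev n := by
    set L : (E →L[ℝ] E') →L[ℝ] E' := ContinuousLinearMap.apply ℝ E' m with hL
    have hle : ∀ x, ‖iteratedFDeriv ℝ n (fun x => _root_.fderiv ℝ v x m) x‖ₑ ^ 2 ≤
        ‖L‖ₑ ^ 2 * ‖iteratedFDeriv ℝ (n + 1) v x‖ₑ ^ 2 := by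
      intro x
      have h1 : ‖iteratedFDeriv ℝ n (L ∘ _root_.fderiv ℝ v) x‖ ≤ ‖L‖ * ‖iteratedFDeriv ℝ n (_root_.fderiv ℝ v) x‖ :=
        L.norm_iteratedFDeriv_comp_left h.fderiv.contDiff.contDiffAt (mod_cast le_top)
      rw [norm_iteratedFDeriv_fderiv] at h1
      rw [← mul_pow]
      gcongr
      rw [← ofReal_norm, ← ofReal_norm, ← ofReal_norm, ← ENNReal.ofReal_mul (norm_nonneg _)]
      exact ENNReal.ofReal_le_ofReal h1
    calc ∫⁻ x, ‖iteratedFDeriv ℝ n (fun x => _root_.fderiv ℝ v x m) x‖ₑ ^ 2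
        ≤ ∫⁻ x, ‖L‖ₑ ^ 2 * ‖iteratedFDeriv ℝ (n + 1) v x‖ₑ ^ 2 := lintegral_mono hle
      _ = ‖L‖ₑ ^ 2 * ∫⁻ x, ‖iteratedFDeriv ℝ (n + 1) v x‖ₑ ^ 2 := lintegral_const_mul' _ _ (by simp)
      _ < ∞ := ENNReal.mul_lt_top (by simp) (h.sobolev (n + 1))

/-- The directional derivatives of a smooth `L²` field are in `L²`. [folklore] -/
theorem memLp_fderiv_apply (h : IsSmoothL2Field v) (m : E) :
    MemLp (fun x => _root_.fderiv ℝ v x m) 2 (volume : Measure E) :=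
  (h.fderiv_apply m).memLp_two

/-- **Closure under the Littlewood–Paley blocks**: `Δ̇_j v` is again a smooth `L²` field
(`Dⁿ(Δ̇_j v) = Δ̇_j(Dⁿ v)` and Young's inequality). [folklore] -/
theorem blockFn [CompleteSpace E'] (h : IsSmoothL2Field v) (j : ℤ) : IsSmoothL2Field (blockFn j v) where
  toHasBoundedDerivs := h.toHasBoundedDerivs.blockFn j
  sobolev n := by
    rw [h.iteratedFDeriv_blockFn j n, lintegral_enorm_sq_lt_top_iff]
    have hU : AEStronglyMeasurable (iteratedFDeriv ℝ n v) (volume : Measure E) :=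
      (h.contDiff.continuous_iteratedFDeriv (mod_cast le_top)).aestronglyMeasurable
    refine (eLpNorm_blockFn_le j hU one_le_two).trans_lt ?_
    exact ENNReal.mul_lt_top (integrable_blockKernel j).2 (h.eLpNorm_iteratedFDeriv_lt_top n)

/-- Scalar multiples. [folklore] -/
theorem const_smul (h : IsSmoothL2Field v) (c : ℝ) : IsSmoothL2Field (c • v) where
  toHasBoundedDerivs := h.toHasBoundedDerivs.const_smul c
  sobolev n := by
    have hle : ∀ x, ‖iteratedFDeriv ℝ n (c • v) x‖ₑ ^ 2 = ‖c‖ₑ ^ 2 * ‖iteratedFDeriv ℝ n v x‖ₑ ^ 2 := by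
      intro x
      rw [iteratedFDeriv_const_smul_apply (h.contDiff_nat n).contDiffAt, enorm_smul, mul_pow]
    simp_rw [hle]
    rw [lintegral_const_mul' _ _ (by simp)]
    exact ENNReal.mul_lt_top (by simp) (h.sobolev n)

/-- `‖x + y‖ₑ² ≤ 2 (‖x‖ₑ² + ‖y‖ₑ²)`. [folklore] -/
theorem enorm_add_sq_le {F : Type*} [SeminormedAddCommGroup F] (x y : F) :
    ‖x + y‖ₑ ^ 2 ≤ 2 * (‖x‖ₑ ^ 2 + ‖y‖ₑ ^ 2) := by
  have h : ‖x + y‖ ^ 2 ≤ 2 * (‖x‖ ^ 2 + ‖y‖ ^ 2) := by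
    nlinarith [norm_add_le x y, sq_nonneg (‖x‖ - ‖y‖), norm_nonneg (x + y), norm_nonneg x,
      norm_nonneg y]
  rw [← ofReal_norm, ← ofReal_norm, ← ofReal_norm, ← ENNReal.ofReal_pow (norm_nonneg _),
    ← ENNReal.ofReal_pow (norm_nonneg _), ← ENNReal.ofReal_pow (norm_nonneg _), ← ENNReal.ofReal_ofNat,
    ← ENNReal.ofReal_add (sq_nonneg _) (sq_nonneg _), ← ENNReal.ofReal_mul (by norm_num)]
  exact ENNReal.ofReal_le_ofReal h

/-- Sums. [folklore] -/
theorem add {w : E → E'} (hv : IsSmoothL2Field v) (hw : IsSmoothL2Field w) : IsSmoothL2Field (v + w) where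
  toHasBoundedDerivs := hv.toHasBoundedDerivs.add hw.toHasBoundedDerivs
  sobolev n := by
    have hle : ∀ x, ‖iteratedFDeriv ℝ n (v + w) x‖ₑ ^ 2 ≤
        2 * (‖iteratedFDeriv ℝ n v x‖ₑ ^ 2 + ‖iteratedFDeriv ℝ n w x‖ₑ ^ 2) := by
      intro x
      rw [iteratedFDeriv_add_apply (hv.contDiff_nat n).contDiffAt (hw.contDiff_nat n).contDiffAt]
      exact enorm_add_sq_le _ _
    refine (lintegral_mono hle).trans_lt ?_
    have hm : Measurable fun x => ‖iteratedFDeriv ℝ n v x‖ₑ ^ 2 :=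
      (hv.contDiff.continuous_iteratedFDeriv (mod_cast le_top)).enorm.measurable.pow_const 2
    rw [lintegral_const_mul' _ _ (by simp), lintegral_add_left hm]
    exact ENNReal.mul_lt_top (by simp) (ENNReal.add_lt_top.2 ⟨hv.sobolev n, hw.sobolev n⟩)

/-- A real finite sum squared against the sum of squares: `(∑_{i<m} a_i)² ≤ m ∑ a_i²` in `ℝ≥0∞`
(Cauchy–Schwarz). [folklore] -/
theorem ennreal_sq_sum_range_le (m : ℕ) (a : ℕ → ℝ≥0∞) :
    (∑ i ∈ Finset.range m, a i) ^ 2 ≤ m * ∑ i ∈ Finset.range m, a i ^ 2 := by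
  have h := ENNReal.inner_le_Lp_mul_Lq (Finset.range m) a (fun _ => (1 : ℝ≥0∞))
    (Real.HolderConjugate.two_two)
  simp only [mul_one, one_pow, Finset.sum_const, Finset.card_range, nsmul_eq_mul, ENNReal.rpow_two] at h
  calc (∑ i ∈ Finset.range m, a i) ^ 2
      ≤ ((∑ i ∈ Finset.range m, a i ^ (2 : ℝ)) ^ (1 / 2 : ℝ) * ((m : ℝ≥0∞)) ^ (1 / 2 : ℝ)) ^ 2 := by
        gcongr
        simpa using h
    _ = m * ∑ i ∈ Finset.range m, a i ^ 2 := by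
        rw [mul_pow, ← ENNReal.rpow_natCast, ← ENNReal.rpow_natCast, ← ENNReal.rpow_mul,
          ← ENNReal.rpow_mul]
        norm_num
        rw [mul_comm]

/-- **Products of a smooth bounded scalar and a smooth `L²` vector field** are smooth `L²` fields
(Leibniz: `‖Dⁿ(φ w)‖ ≤ ∑ C(n,i) ‖Dⁱφ‖_∞ ‖Dⁿ⁻ⁱ w‖`, a finite sum of `L²` functions). [folklore] -/
theorem smul_left {φ : E → ℝ} {w : E → E'} (hφ : HasBoundedDerivs φ) (hw : IsSmoothL2Field w) :
    IsSmoothL2Field (fun x => φ x • w x) where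
  toHasBoundedDerivs := hφ.smul hw.toHasBoundedDerivs
  sobolev n := by
    choose M hM using hφ.bounded
    -- pointwise Leibniz bound, in `ℝ≥0∞`
    set a : E → ℕ → ℝ≥0∞ := fun x i =>
      ENNReal.ofReal ((n.choose i : ℝ) * M i) * ‖iteratedFDeriv ℝ (n - i) w x‖ₑ with ha
    have hle : ∀ x, ‖iteratedFDeriv ℝ n (fun y => φ y • w y) x‖ₑ ≤ ∑ i ∈ Finset.range (n + 1), a x i := by
      intro x
      have h1 := norm_iteratedFDeriv_smul_le hφ.contDiff hw.contDiff x (n := n) (mod_cast le_top)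
      have h2 : ‖iteratedFDeriv ℝ n (fun y => φ y • w y) x‖ ≤
          ∑ i ∈ Finset.range (n + 1), (n.choose i : ℝ) * M i * ‖iteratedFDeriv ℝ (n - i) w x‖ := by
        refine h1.trans (Finset.sum_le_sum fun i _ => ?_)
        exact mul_le_mul_of_nonneg_right (mul_le_mul_of_nonneg_left (hM i x) (Nat.cast_nonneg _))
          (norm_nonneg _)
      rw [← ofReal_norm]
      refine (ENNReal.ofReal_le_ofReal h2).trans ?_
      rw [ENNReal.ofReal_sum_of_nonneg fun i _ => mul_nonneg (mul_nonneg (Nat.cast_nonneg _)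
        ((norm_nonneg _).trans (hM i x))) (norm_nonneg _)]
      refine Finset.sum_le_sum fun i _ => ?_
      rw [ha, ENNReal.ofReal_mul (mul_nonneg (Nat.cast_nonneg _) ((norm_nonneg _).trans (hM i x))),
        ofReal_norm]
    -- square and integrate
    have hsq : ∀ x, ‖iteratedFDeriv ℝ n (fun y => φ y • w y) x‖ₑ ^ 2 ≤
        (n + 1 : ℕ) * ∑ i ∈ Finset.range (n + 1), a x i ^ 2 := fun x =>
      (pow_le_pow_left' (hle x) 2).trans (ennreal_sq_sum_range_le (n + 1) (a x))
    refine (lintegral_mono hsq).trans_lt ?_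
    have hmeas : ∀ i, Measurable fun x => a x i ^ 2 := fun i =>
      (measurable_const.mul (hw.contDiff.continuous_iteratedFDeriv (m := n - i)
        (WithTop.coe_le_coe.2 le_top)).enorm.measurable).pow_const 2
    rw [lintegral_const_mul' _ _ (by simp), lintegral_finsetSum _ fun i _ => hmeas i]
    refine ENNReal.mul_lt_top (by simp) (ENNReal.sum_lt_top.2 fun i _ => ?_)
    simp only [ha, mul_pow]
    rw [lintegral_const_mul' _ _ (ENNReal.pow_ne_top ENNReal.ofReal_ne_top)]
    exact ENNReal.mul_lt_top (ENNReal.pow_lt_top ENNReal.ofReal_lt_top) (hw.sobolev (n - i))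

end IsSmoothL2Field

end Blocks

end Literature.Analysis.FunctionSpaces

end
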